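import Mathlib
import Summits.MatrixMultiplication.MatrixMultiplication.Theses.CommutativeSchemes

/-!
# `RealizationSRank` — CU13 Prop. 9 + §4.3 (route CommutativeSchemes, item 9466)

A commutative association scheme with `r` classes (class map `cls : X → X → Fin r`, one diagonal
class, transpose-closed, intersection numbers `p a b c` symmetric in `a b`) realising `⟨n,n,n⟩`
through `α β γ : [n]² → Fin r` yields a tensor `t` on `([n]²)³` with exactly the support of the
tree's `matMulTensor ℂ n n n` and `tensorRank t ≤ r` (Cohn–Umans 2013, Prop. 9 and §4.3).

Proof (all def-free; auxiliary objects are packaged as existence statements).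
* `t i j k := trace (A_{α(i₂,i₁)} A_{β j} A_{γ k})` counts the triangles `x y z` with
  `cls x y = α(i₂,i₁)`, `cls y z = β j`, `cls z x = γ k` (`trace_adj_mul_ne_zero_iff`), so the
  realisation axiom gives the support of `⟨n,n,n⟩`.
* The pattern matrices `M x y = m (cls x y)` form a commutative subalgebra of `Matrix X X ℂ`
  closed under conjugate transpose, of dimension `≤ r`, containing the adjacency matrices `A_a`
  (`exists_pattern_algebra`; multiplication through the intersection numbers, `pattern_mul_apply`).
* For such an algebra `𝒜`, the joint eigenspaces `V_χ` of its Hermitian elements decompose `ℂ^X`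
  (Mathlib: `LinearMap.IsSymmetric.directSum_isInternal_of_pairwise_commute`) and every `M ∈ 𝒜`,
  `M = H₁ + i H₂`, acts on `V_χ` by a scalar `σ_χ(M)` (`exists_joint_scalar`).
* Hence `trace M = ∑_χ dim V_χ · σ_χ(M)` with `σ_χ` multiplicative, and the number of non-zero
  `V_χ` is at most `dim 𝒜 ≤ r` because the `σ_χ` are distinct characters of `𝒜`, linearly
  independent by Dedekind (`linearIndependent_monoidHom`) inside the dual of `𝒜`
  (`trace_eq_sum_of_joint_scalar`).  So `t = ∑_χ (dim V_χ σ_χ(A_α)) ⊗ σ_χ(A_β) ⊗ σ_χ(A_γ)` has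
  rank `≤ r`.
-/

set_option linter.dupNamespace false

noncomputable section

open scoped BigOperators ComplexConjugate Matrix
open Module Literature.Computability.AlgebraicComplexity

namespace Summit.MatrixMultiplication.MatrixMultiplication.Theorems

namespace RealizationSRankProof

/-! ### Commutative `*`-closed matrix algebras: trace through joint eigenspaces -/

section Spectral

variable {X : Type} [Fintype X] [DecidableEq X]

/-- Joint eigenspaces of the Hermitian elements of a commutative `ᴴ`-closed subalgebra `𝒜` of
`Matrix X X ℂ`: an independent family of subspaces of `ℂ^X` spanning it, on each of which every
`M ∈ 𝒜` acts by a scalar `σ χ M`, and whose non-zero members are separated by these scalars. -/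
theorem exists_joint_scalar (A : Subalgebra ℂ (Matrix X X ℂ))
    (hcomm : ∀ M ∈ A, ∀ N ∈ A, M * N = N * M) (hstar : ∀ M ∈ A, Mᴴ ∈ A) :
    ∃ (J : Type) (V : J → Submodule ℂ (EuclideanSpace ℂ X)) (σ : J → Matrix X X ℂ → ℂ),
      iSupIndep V ∧ iSup V = ⊤ ∧
      (∀ χ, ∀ M ∈ A, ∀ v ∈ V χ, Matrix.toEuclideanLin M v = σ χ M • v) ∧
      ∀ χ χ', V χ ≠ ⊥ → V χ' ≠ ⊥ → (∀ M ∈ A, σ χ M = σ χ' M) → χ = χ' := by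
  classical
  have h2 : star (2⁻¹ : ℂ) = 2⁻¹ := by simp
  -- Hermitian and skew-Hermitian parts
  have hH₁ : ∀ M ∈ A, (2⁻¹ : ℂ) • (M + Mᴴ) ∈ A ∧ ((2⁻¹ : ℂ) • (M + Mᴴ)).IsHermitian := by
    intro M hM
    refine ⟨A.smul_mem (A.add_mem hM (hstar M hM)) _, ?_⟩
    show ((2⁻¹ : ℂ) • (M + Mᴴ))ᴴ = (2⁻¹ : ℂ) • (M + Mᴴ)
    rw [Matrix.conjTranspose_smul, h2, Matrix.conjTranspose_add, Matrix.conjTranspose_conjTranspose,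
      add_comm]
  have hH₂ : ∀ M ∈ A, (2⁻¹ : ℂ) • (Complex.I • (Mᴴ - M)) ∈ A ∧
      ((2⁻¹ : ℂ) • (Complex.I • (Mᴴ - M))).IsHermitian := by
    intro M hM
    refine ⟨A.smul_mem (A.smul_mem (A.sub_mem (hstar M hM) hM) _) _, ?_⟩
    show ((2⁻¹ : ℂ) • (Complex.I • (Mᴴ - M)))ᴴ = (2⁻¹ : ℂ) • (Complex.I • (Mᴴ - M))
    rw [Matrix.conjTranspose_smul, h2, Matrix.conjTranspose_smul, Matrix.conjTranspose_sub,
      Matrix.conjTranspose_conjTranspose, Complex.star_def, Complex.conj_I, neg_smul, ← smul_neg,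
      neg_sub]
  have hdecomp : ∀ M : Matrix X X ℂ,
      (2⁻¹ : ℂ) • (M + Mᴴ) + Complex.I • ((2⁻¹ : ℂ) • (Complex.I • (Mᴴ - M))) = M := by
    intro M
    ext x y
    simp only [Matrix.add_apply, Matrix.smul_apply, Matrix.sub_apply, Matrix.conjTranspose_apply,
      smul_eq_mul]
    linear_combination (2⁻¹ * (star (M y x) - M x y) : ℂ) * Complex.I_mul_I
  -- the commuting family of symmetric operators
  let T : {M : Matrix X X ℂ // M ∈ A ∧ M.IsHermitian} → Module.End ℂ (EuclideanSpace ℂ X) :=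
    fun j => Matrix.toEuclideanLin j.1
  have hT : ∀ j, (T j).IsSymmetric := fun j => Matrix.isSymmetric_toEuclideanLin_iff.mpr j.2.2
  have hC : Pairwise (Function.onFun Commute T) := by
    intro j j' _
    change T j * T j' = T j' * T j
    simp only [T, Module.End.mul_eq_comp, ← Matrix.toLpLin_mul_same, hcomm _ j.2.1 _ j'.2.1]
  have hInt := LinearMap.IsSymmetric.directSum_isInternal_of_pairwise_commute hT hC
  let V : ({M : Matrix X X ℂ // M ∈ A ∧ M.IsHermitian} → ℂ) → Submodule ℂ (EuclideanSpace ℂ X) :=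
    fun χ => ⨅ j, Module.End.eigenspace (T j) (χ j)
  let σ : ({M : Matrix X X ℂ // M ∈ A ∧ M.IsHermitian} → ℂ) → Matrix X X ℂ → ℂ :=
    fun χ M => if hM : M ∈ A then χ ⟨_, hH₁ M hM⟩ + Complex.I * χ ⟨_, hH₂ M hM⟩ else 0
  have hV : ∀ χ, ∀ v ∈ V χ, ∀ j, T j v = χ j • v := fun χ v hv j =>
    Module.End.mem_eigenspace_iff.1 ((Submodule.mem_iInf _).1 hv j)
  have hscalar : ∀ χ, ∀ M ∈ A, ∀ v ∈ V χ, Matrix.toEuclideanLin M v = σ χ M • v := by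
    intro χ M hM v hv
    have e1 := hV χ v hv ⟨_, hH₁ M hM⟩
    have e2 := hV χ v hv ⟨_, hH₂ M hM⟩
    simp only [T] at e1 e2
    simp only [σ, dif_pos hM]
    conv_lhs => rw [← hdecomp M]
    rw [map_add, map_smul Matrix.toEuclideanLin Complex.I, LinearMap.add_apply,
      LinearMap.smul_apply, e1, e2, smul_smul, ← add_smul]
  refine ⟨_, V, σ, hInt.submodule_iSupIndep, hInt.submodule_iSup_eq_top, hscalar, ?_⟩
  intro χ χ' hχ hχ' hσ
  funext j
  obtain ⟨v, hv, hv0⟩ := (Submodule.ne_bot_iff _).1 hχ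
  obtain ⟨v', hv', hv0'⟩ := (Submodule.ne_bot_iff _).1 hχ'
  have e1 : σ χ j.1 • v = χ j • v := by rw [← hscalar χ j.1 j.2.1 v hv, ← hV χ v hv j]
  have e2 : σ χ' j.1 • v' = χ' j • v' := by rw [← hscalar χ' j.1 j.2.1 v' hv', ← hV χ' v' hv' j]
  rw [← smul_left_injective ℂ hv0 e1, ← smul_left_injective ℂ hv0' e2]
  exact hσ j.1 j.2.1

/-- Trace formula and character count: if an independent spanning family of subspaces `V χ` of
`ℂ^X` carries scalar actions `σ χ` of a subalgebra `𝒜 ≤ Matrix X X ℂ` separating its non-zero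
members, then there are `k ≤ dim 𝒜` multiplicative functionals `φ s` and multiplicities `d s`
with `trace M = ∑ s, d s * φ s M` for every `M ∈ 𝒜` (Dedekind's independence of characters
bounds `k`). -/
theorem trace_eq_sum_of_joint_scalar (A : Subalgebra ℂ (Matrix X X ℂ)) {J : Type}
    (V : J → Submodule ℂ (EuclideanSpace ℂ X)) (σ : J → Matrix X X ℂ → ℂ)
    (hind : iSupIndep V) (htop : iSup V = ⊤)
    (hσ : ∀ χ, ∀ M ∈ A, ∀ v ∈ V χ, Matrix.toEuclideanLin M v = σ χ M • v)
    (hsep : ∀ χ χ', V χ ≠ ⊥ → V χ' ≠ ⊥ → (∀ M ∈ A, σ χ M = σ χ' M) → χ = χ') :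
    ∃ (k : ℕ) (φ : Fin k → Matrix X X ℂ → ℂ) (d : Fin k → ℕ),
      k ≤ finrank ℂ A ∧
      (∀ s, ∀ M ∈ A, ∀ N ∈ A, φ s (M * N) = φ s M * φ s N) ∧
      ∀ M ∈ A, M.trace = ∑ s, (d s : ℂ) * φ s M := by
  classical
  haveI : FiniteDimensional ℂ A :=
    FiniteDimensional.of_injective A.val.toLinearMap Subtype.val_injective
  have hInt : DirectSum.IsInternal V :=
    (DirectSum.isInternal_submodule_iff_iSupIndep_and_iSup_eq_top V).2 ⟨hind, htop⟩
  have hfin : {χ | V χ ≠ ⊥}.Finite := WellFoundedGT.finite_ne_bot_of_iSupIndep hind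
  set K := hfin.toFinset with hK
  have hKmem : ∀ χ, χ ∈ K ↔ V χ ≠ ⊥ := fun χ => by simp [hK]
  have key : ∀ χ, V χ ≠ ⊥ → ∃ v ∈ V χ, v ≠ 0 := fun χ h => (Submodule.ne_bot_iff _).1 h
  -- algebraic properties of the scalars on non-zero joint eigenspaces
  have hmul : ∀ χ, V χ ≠ ⊥ → ∀ M ∈ A, ∀ N ∈ A, σ χ (M * N) = σ χ M * σ χ N := by
    intro χ hχ M hM N hN
    obtain ⟨v, hv, hv0⟩ := key χ hχ
    have h1 := hσ χ (M * N) (A.mul_mem hM hN) v hv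
    rw [Matrix.toLpLin_mul_same, LinearMap.comp_apply, hσ χ N hN v hv, map_smul,
      hσ χ M hM v hv, smul_smul, mul_comm] at h1
    exact (smul_left_injective ℂ hv0 h1).symm
  have hone : ∀ χ, V χ ≠ ⊥ → σ χ 1 = 1 := by
    intro χ hχ
    obtain ⟨v, hv, hv0⟩ := key χ hχ
    have h1 := hσ χ 1 A.one_mem v hv
    rw [Matrix.toLpLin_one, LinearMap.id_apply] at h1
    refine smul_left_injective ℂ hv0 ?_
    simp only [one_smul]
    exact h1.symm
  have hadd : ∀ χ, V χ ≠ ⊥ → ∀ M ∈ A, ∀ N ∈ A, σ χ (M + N) = σ χ M + σ χ N := by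
    intro χ hχ M hM N hN
    obtain ⟨v, hv, hv0⟩ := key χ hχ
    have h1 := hσ χ (M + N) (A.add_mem hM hN) v hv
    rw [map_add, LinearMap.add_apply, hσ χ N hN v hv, hσ χ M hM v hv, ← add_smul] at h1
    exact (smul_left_injective ℂ hv0 h1).symm
  have hsmul : ∀ χ, V χ ≠ ⊥ → ∀ (c : ℂ), ∀ M ∈ A, σ χ (c • M) = c * σ χ M := by
    intro χ hχ c M hM
    obtain ⟨v, hv, hv0⟩ := key χ hχ
    have h1 := hσ χ (c • M) (A.smul_mem hM c) v hv
    rw [map_smul, LinearMap.smul_apply, hσ χ M hM v hv, smul_smul] at h1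
    exact (smul_left_injective ℂ hv0 h1).symm
  -- trace formula
  have htr : ∀ M ∈ A, M.trace = ∑ χ ∈ K, (finrank ℂ (V χ) : ℂ) * σ χ M := by
    intro M hM
    have hf : ∀ χ, Set.MapsTo (Matrix.toEuclideanLin M) (V χ) (V χ) := by
      intro χ v hv
      show Matrix.toEuclideanLin M v ∈ V χ
      rw [hσ χ M hM v hv]
      exact (V χ).smul_mem _ hv
    have h1 := LinearMap.trace_eq_sum_trace_restrict' hInt hfin hf
    have h2 : LinearMap.trace ℂ _ (Matrix.toEuclideanLin M) = M.trace := by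
      simp only [Matrix.toEuclideanLin, Matrix.toLpLin_eq_toLin, Matrix.trace_toLin_eq]
    rw [← h2, h1]
    refine Finset.sum_congr rfl fun χ _ => ?_
    have h3 : (Matrix.toEuclideanLin M).restrict (hf χ) = σ χ M • LinearMap.id := by
      refine LinearMap.ext fun v => Subtype.ext ?_
      rw [LinearMap.coe_restrict_apply, LinearMap.smul_apply, LinearMap.id_apply,
        Submodule.coe_smul]
      exact hσ χ M hM v.1 v.2
    rw [h3, map_smul, LinearMap.trace_id, smul_eq_mul, mul_comm]
  -- Dedekind: the number of non-zero joint eigenspaces is at most `dim A`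
  have hKne : ∀ χ : K, V χ.1 ≠ ⊥ := fun χ => (hKmem χ.1).1 χ.2
  have hcard : K.card ≤ finrank ℂ A := by
    let ψ : K → (A →* ℂ) := fun χ =>
      { toFun := fun M => σ χ.1 M.1
        map_one' := hone χ.1 (hKne χ)
        map_mul' := fun M N => hmul χ.1 (hKne χ) M.1 M.2 N.1 N.2 }
    have hψ : Function.Injective ψ := by
      intro χ χ' h
      apply Subtype.ext
      refine hsep χ.1 χ'.1 (hKne χ) (hKne χ') fun M hM => ?_
      exact DFunLike.congr_fun h ⟨M, hM⟩
    have hli := (linearIndependent_monoidHom A ℂ).comp ψ hψ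
    let ℓ : K → Module.Dual ℂ A := fun χ =>
      { toFun := fun M => σ χ.1 M.1
        map_add' := fun M N => hadd χ.1 (hKne χ) M.1 M.2 N.1 N.2
        map_smul' := fun c M => hsmul χ.1 (hKne χ) c M.1 M.2 }
    let coeL : Module.Dual ℂ A →ₗ[ℂ] (A → ℂ) :=
      { toFun := fun f => ⇑f, map_add' := fun _ _ => rfl, map_smul' := fun _ _ => rfl }
    have hcomp : coeL ∘ ℓ = (fun f : A →* ℂ => ⇑f) ∘ ψ := by
      funext χ
      rfl
    have hli' : LinearIndependent ℂ ℓ := LinearIndependent.of_comp coeL (by rw [hcomp]; exact hli)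
    have := hli'.fintype_card_le_finrank
    rw [Subspace.dual_finrank_eq, Fintype.card_coe] at this
    exact this
  -- package, reindexing the non-zero joint eigenspaces by `Fin k`
  refine ⟨K.card, fun s M => σ (K.equivFin.symm s).1 M, fun s => finrank ℂ (V (K.equivFin.symm s).1),
    hcard, fun s M hM N hN => hmul _ (hKne _) M hM N hN, fun M hM => ?_⟩
  rw [htr M hM, ← Finset.sum_coe_sort K]
  exact (Equiv.sum_comp K.equivFin.symm (fun χ : K => (finrank ℂ (V χ.1) : ℂ) * σ χ.1 M)).symm

/-- Combination of `exists_joint_scalar` and `trace_eq_sum_of_joint_scalar`: on a commutative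
`ᴴ`-closed subalgebra `𝒜` of `Matrix X X ℂ` the trace is a non-negative integer combination of at
most `dim 𝒜` multiplicative functionals (i.e. `𝒜 ≅ ℂ^k`, read through the trace form). -/
theorem exists_trace_characters (A : Subalgebra ℂ (Matrix X X ℂ))
    (hcomm : ∀ M ∈ A, ∀ N ∈ A, M * N = N * M) (hstar : ∀ M ∈ A, Mᴴ ∈ A) :
    ∃ (k : ℕ) (φ : Fin k → Matrix X X ℂ → ℂ) (d : Fin k → ℕ),
      k ≤ finrank ℂ A ∧
      (∀ s, ∀ M ∈ A, ∀ N ∈ A, φ s (M * N) = φ s M * φ s N) ∧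
      ∀ M ∈ A, M.trace = ∑ s, (d s : ℂ) * φ s M := by
  obtain ⟨J, V, σ, hind, htop, hσ, hsep⟩ := exists_joint_scalar A hcomm hstar
  exact trace_eq_sum_of_joint_scalar A V σ hind htop hσ hsep

end Spectral

/-! ### The pattern (Bose–Mesner) algebra of a commutative scheme -/

section Scheme

variable {X : Type} [Fintype X] [DecidableEq X] {r : ℕ}

omit [DecidableEq X] in
/-- Entries of a product of two pattern matrices `M x y = m (cls x y)`, `N x y = n (cls x y)`
through the intersection numbers: `(MN) x y = ∑ a b, p a b (cls x y) · m a · n b`. -/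
theorem pattern_mul_apply (cls : X → X → Fin r) (p : Fin r → Fin r → Fin r → ℕ)
    (hp : ∀ (a b : Fin r) (x y : X),
      (Finset.univ.filter (fun z : X => cls x z = a ∧ cls z y = b)).card = p a b (cls x y))
    {M N : Matrix X X ℂ} {m n : Fin r → ℂ} (hM : ∀ x y, M x y = m (cls x y))
    (hN : ∀ x y, N x y = n (cls x y)) (x y : X) :
    (M * N) x y = ∑ a, ∑ b, (p a b (cls x y) : ℂ) * (m a * n b) := by
  rw [Matrix.mul_apply]
  simp_rw [hM, hN]
  rw [← Finset.sum_fiberwise' Finset.univ (fun z => (cls x z, cls z y)) (fun ab => m ab.1 * n ab.2),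
    Fintype.sum_prod_type]
  refine Finset.sum_congr rfl fun a _ => Finset.sum_congr rfl fun b _ => ?_
  rw [Finset.sum_const, nsmul_eq_mul]
  congr 2
  rw [← hp a b x y]
  congr 1
  exact Finset.filter_congr fun z _ => Prod.ext_iff

/-- The pattern matrices of a commutative association scheme form a commutative subalgebra of
`Matrix X X ℂ`, closed under conjugate transpose, containing the adjacency matrices of the
classes, of dimension at most the number `r` of classes. -/
theorem exists_pattern_algebra (cls : X → X → Fin r)
    (h1 : ∀ x y z : X, cls x y = cls z z ↔ x = y)
    (h2 : ∃ τ : Fin r → Fin r, ∀ x y : X, cls y x = τ (cls x y))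
    (h3 : ∃ p : Fin r → Fin r → Fin r → ℕ, (∀ (a b : Fin r) (x y : X),
      (Finset.univ.filter (fun z : X => cls x z = a ∧ cls z y = b)).card = p a b (cls x y)) ∧
      ∀ a b c : Fin r, p a b c = p b a c)
    (adj : Fin r → Matrix X X ℂ) (hadj : ∀ a x y, adj a x y = if cls x y = a then 1 else 0) :
    ∃ A : Subalgebra ℂ (Matrix X X ℂ),
      (∀ M ∈ A, ∀ N ∈ A, M * N = N * M) ∧ (∀ M ∈ A, Mᴴ ∈ A) ∧ (∀ a, adj a ∈ A) ∧
      finrank ℂ A ≤ r := by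
  obtain ⟨τ, hτ⟩ := h2
  obtain ⟨p, hp, hpcomm⟩ := h3
  let S : Submodule ℂ (Matrix X X ℂ) :=
    { carrier := {M | ∃ m : Fin r → ℂ, ∀ x y, M x y = m (cls x y)}
      add_mem' := by
        rintro M N ⟨m, hm⟩ ⟨n, hn⟩
        exact ⟨m + n, fun x y => by simp [hm, hn]⟩
      zero_mem' := ⟨0, fun x y => by simp⟩
      smul_mem' := by
        rintro c M ⟨m, hm⟩
        exact ⟨c • m, fun x y => by simp [hm]⟩ }
  have hS : ∀ M, M ∈ S ↔ ∃ m : Fin r → ℂ, ∀ x y, M x y = m (cls x y) := fun M => Iff.rfl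
  have h_one : (1 : Matrix X X ℂ) ∈ S := by
    refine (hS 1).2 ⟨fun a => if ∃ z, cls z z = a then 1 else 0, fun x y => ?_⟩
    show (1 : Matrix X X ℂ) x y = if ∃ z, cls z z = cls x y then (1 : ℂ) else 0
    rw [Matrix.one_apply]
    by_cases hxy : x = y
    · rw [if_pos hxy, if_pos ⟨x, ((h1 x y x).2 hxy).symm⟩]
    · rw [if_neg hxy, if_neg]
      rintro ⟨z, hz⟩
      exact hxy ((h1 x y z).1 hz.symm)
  have h_mul : ∀ M N, M ∈ S → N ∈ S → M * N ∈ S := by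
    rintro M N ⟨m, hm⟩ ⟨n, hn⟩
    exact ⟨fun c => ∑ a, ∑ b, (p a b c : ℂ) * (m a * n b),
      fun x y => pattern_mul_apply cls p hp hm hn x y⟩
  refine ⟨S.toSubalgebra h_one h_mul, ?_, ?_, ?_, ?_⟩
  · -- commutativity, from `p a b c = p b a c`
    rintro M ⟨m, hm⟩ N ⟨n, hn⟩
    ext x y
    rw [pattern_mul_apply cls p hp hm hn, pattern_mul_apply cls p hp hn hm, Finset.sum_comm]
    refine Finset.sum_congr rfl fun a _ => Finset.sum_congr rfl fun b _ => ?_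
    rw [hpcomm b a]
    ring
  · -- closed under conjugate transpose, from transpose-closure of the classes
    rintro M ⟨m, hm⟩
    refine ⟨fun c => star (m (τ c)), fun x y => ?_⟩
    rw [Matrix.conjTranspose_apply, hm, hτ]
  · -- adjacency matrices are pattern matrices
    intro a
    exact ⟨fun c => if c = a then 1 else 0, fun x y => hadj a x y⟩
  · -- dimension: pattern matrices are combinations of the `r` adjacency matrices
    have hle : S ≤ Submodule.span ℂ (Set.range adj) := by
      rintro M ⟨m, hm⟩
      have hM : M = ∑ a, m a • adj a := by
        ext x y
        simp only [Matrix.sum_apply, Matrix.smul_apply, hadj, smul_eq_mul, mul_ite, mul_one,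
          mul_zero, Finset.sum_ite_eq, Finset.mem_univ, if_true, hm]
      rw [hM]
      exact Submodule.sum_mem _ fun a _ => Submodule.smul_mem _ _ (Submodule.subset_span ⟨a, rfl⟩)
    calc finrank ℂ (S.toSubalgebra h_one h_mul)
        = finrank ℂ (Subalgebra.toSubmodule (S.toSubalgebra h_one h_mul)) :=
          (Subalgebra.finrank_toSubmodule _).symm
      _ = finrank ℂ S := by rw [Submodule.toSubalgebra_toSubmodule]
      _ ≤ finrank ℂ (Submodule.span ℂ (Set.range adj)) := Submodule.finrank_mono hle
      _ ≤ Fintype.card (Fin r) := finrank_range_le_card adj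
      _ = r := Fintype.card_fin r

omit [DecidableEq X] in
/-- `trace (A_a A_b A_c)` is non-zero iff there is a triangle `x y z` with `cls x y = a`,
`cls y z = b`, `cls z x = c` (it is the number of such triangles). -/
theorem trace_adj_mul_ne_zero_iff (cls : X → X → Fin r) (adj : Fin r → Matrix X X ℂ)
    (hadj : ∀ a x y, adj a x y = if cls x y = a then 1 else 0) (a b c : Fin r) :
    (adj a * adj b * adj c).trace ≠ 0 ↔ ∃ x y z, cls x y = a ∧ cls y z = b ∧ cls z x = c := by
  have key : (adj a * adj b * adj c).trace =
      ((∑ x, ∑ z, ∑ y, if cls x y = a ∧ cls y z = b ∧ cls z x = c then 1 else 0 : ℕ) : ℂ) := by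
    push_cast
    simp only [Matrix.trace, Matrix.diag_apply, Matrix.mul_apply, hadj, Finset.sum_mul]
    refine Finset.sum_congr rfl fun x _ => Finset.sum_congr rfl fun z _ =>
      Finset.sum_congr rfl fun y _ => ?_
    by_cases hxy : cls x y = a <;> by_cases hyz : cls y z = b <;> by_cases hzx : cls z x = c <;>
      simp [hxy, hyz, hzx]
  rw [key, Nat.cast_ne_zero]
  simp only [Ne, Finset.sum_eq_zero_iff, Finset.mem_univ, true_implies, ite_eq_right_iff,
    one_ne_zero, imp_false, not_forall, not_not]
  constructor
  · rintro ⟨x, z, y, h⟩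
    exact ⟨x, y, z, h⟩
  · rintro ⟨x, y, z, h⟩
    exact ⟨x, z, y, h⟩

end Scheme

end RealizationSRankProof

open RealizationSRankProof in
/-- **`RealizationSRank`** (item stmt-MatrixMultiplication-9466; Cohn–Umans 2013, Prop. 9 and
§4.3): a commutative association scheme with `r` classes realising `⟨n,n,n⟩` yields a tensor with
exactly the support of `matMulTensor ℂ n n n` and tensor rank at most `r` — the triangle counts
`trace (A_{α(i₂,i₁)} A_{β j} A_{γ k})`, a restriction of the trace form of the pattern algebra
`≅ ℂ^k`, `k ≤ r`. -/
theorem realizationSRank_proof : Theses.CommutativeSchemes.RealizationSRank := by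
  intro n X _ r cls h1 h2 h3 α β γ hreal
  classical
  obtain ⟨-, -, -, hreal⟩ := hreal
  set adj : Fin r → Matrix X X ℂ := fun a => Matrix.of fun x y => if cls x y = a then (1 : ℂ) else 0
    with hadj_def
  have hadj : ∀ a x y, adj a x y = if cls x y = a then 1 else 0 := fun a x y => rfl
  obtain ⟨A, hcomm, hstar, hadjA, hfin⟩ := exists_pattern_algebra cls h1 h2 h3 adj hadj
  obtain ⟨k, φ, d, hk, hφ, htr⟩ := exists_trace_characters A hcomm hstar
  refine ⟨fun i j k => (adj (α (i.2, i.1)) * adj (β j) * adj (γ k)).trace, ?_, ?_⟩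
  · -- support: triangles ⟺ the realisation condition ⟺ the support of `⟨n,n,n⟩`
    rintro ⟨i₁, i₂⟩ ⟨j₁, j₂⟩ ⟨k₁, k₂⟩
    rw [trace_adj_mul_ne_zero_iff cls adj hadj, hreal i₂ k₂ j₁ i₁ k₁ j₂]
    simp only [matMulTensor, Ne, ite_eq_right_iff, one_ne_zero, imp_false, not_not]
    constructor
    · rintro ⟨e₁, e₂, e₃⟩
      exact ⟨e₂.symm, e₃.symm, e₁⟩
    · rintro ⟨e₁, e₂, e₃⟩
      exact ⟨e₃, e₁.symm, e₂.symm⟩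
  · -- rank: `t = ∑_s (d s · φ s (A_α)) ⊗ φ s (A_β) ⊗ φ s (A_γ)` with `k ≤ dim A ≤ r` terms
    refine le_trans (tensorRank_le_of_eq_sum (fun s i => (d s : ℂ) * φ s (adj (α (i.2, i.1))))
      (fun s j => φ s (adj (β j))) (fun s k => φ s (adj (γ k))) ?_) (hk.trans hfin)
    funext i j k
    rw [htr _ (A.mul_mem (A.mul_mem (hadjA _) (hadjA _)) (hadjA _))]
    simp only [Finset.sum_apply, triad_apply]
    refine Finset.sum_congr rfl fun s _ => ?_
    rw [hφ s _ (A.mul_mem (hadjA _) (hadjA _)) _ (hadjA _), hφ s _ (hadjA _) _ (hadjA _)]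
    ring

end Summit.MatrixMultiplication.MatrixMultiplication.Theorems

end
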